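import Summits.ResolutionOfSingularities.ResolutionOfSingularities.Theorems.EquisingularLiftEquisingularLiftNatEquinodalNoseDatumOfSections
import Summits.ResolutionOfSingularities.ResolutionOfSingularities.Theorems.EquisingularLiftEquisingularLiftNatEquinodalSectionOfVec
import Literature.AlgebraicGeometry.Resolution.AlterationsSections
import HarnessLib

/-!
# [OURS · L1 W4.5(b) · EL♮(3) · door ν4, brick N-0 (JINIT at `RD := RPlus`)] CONDITIONAL ASSEMBLY, LEVEL C — ★ `coreS_of_cores`:
# the SECTIONS core `coreS` of ✓ `noseDatum_initial_of_sections` from FOUR smaller cores (W5 · S4 · S7 · S8) — the node sections are BUILT here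

res-L1-w45b-nose-w1 g4 (WIDTH seat D-0157 DOOR 1; N-0 owner).  DEF-FREE; no `sorry`; standard axioms.  `--supports stmt-ResolutionOfSingularities-20148
--as helper`, counted 0.

WHAT.  Statement = `coreS` of ✓ `noseDatum_initial_of_sections` VERBATIM, under ONE hypothesis `cores` = the CONJUNCTION of four cores (W5 ∧ S4 ∧ S7 ∧ S8,
one binder list to respect the 400-line rule) over `coreS`'s binders PLUS the constructed data: the
node sections `𝔰 i = [av i]` (✓ `SectionOfVec`: the explicit `O`-point through `D₊(x_{dv i})`, `av i = uᵢ⁻¹ • (B̃ · nO i)`, `av i (dv i) = 1`) and the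
marked closed points `w i` with `Proj φ (w i) = 𝔰 i (𝔪)`.  DISCHARGED HERE (kernel): the CONSTRUCTION (a unit coordinate of `B̃·nO i` exists since its
reduction `B vᵢ ≠ 0` — the `r`-minor of `B` is invertible and `vᵢ c = 1`), S1 (✓ `sectionOfVec_comp_eq_id`), S2 `𝓦₀ ≤ ker 𝔰 i` (✓ `projIdealSheaf_le_ker_sectionOfVec`:
`L̃(B̃ n) = (ψ̃ L̃)(n) = 0`, `Ĝ(B̃ n) = (ψ̃ σ̃ G̃)(n) = G̃(n) = 0`, homogeneity scaling), S3 (`w i` chosen in `range (Proj φ) = q⁻¹{𝔪}`, base square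
✓ `ProjectiveAmbientFibre.isPullback_projMap`), S5 `w i ∈ Z` (the reduced trace `𝓦₀·𝒪_{ℙ³_k} = 𝓘⟨Z⟩` re-derived as in Level B + ✓ (S-dict)), S6 (a section of
the separated `q` is a closed immersion, Literature ✓ `IsUnionOfSections.isClosedImmersion_of_comp_eq_id`).  REMAINING cores: `coreW5` (regular off the
sections; ring core ✓ …NatEquinodalNodeRegularCore/Taylor), `coreS4` (`w` injective), `coreS7` (the iff-clause on `Z̃`), `coreS8` (`SplitNodeAt`, junction
✓ `nodeChart_hypotheses`).  EL♮(3) is NOT proved; resolution of singularities in positive characteristic is NOT proved.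
-/

set_option linter.dupNamespace false -- mandated namespace `Summit.<Summit>.<Problem>` of this single-conjunct summit
set_option linter.overlappingInstances false -- signatures carry `[IsDomain O] [IsDiscreteValuationRing O]`

noncomputable section

open CategoryTheory CategoryTheory.Limits AlgebraicGeometry TopologicalSpace Topology IsLocalRing
open MvPolynomial
open Literature.AlgebraicGeometry.Resolution
open AlgebraicGeometry.Scheme.IdealSheafData
open Summit.ResolutionOfSingularities.ResolutionOfSingularities.Theses.EquisingularLift.Split
open Summit.ResolutionOfSingularities.ResolutionOfSingularities.Cruxes.EquisingularLift.StrataSplit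

namespace Summit.ResolutionOfSingularities.ResolutionOfSingularities.Cruxes.EquisingularLiftNat.Sections.Equinodal

/-- a form of degree `m` is a homogeneous function: `F(c • x) = c^m · F(x)`. [folklore] -/
theorem eval_smul_of_mem_homogeneousSubmodule {R : Type*} [CommRing R] {σ : Type*} [Fintype σ] (F : MvPolynomial σ R) {m : ℕ}
    (hF : F ∈ homogeneousSubmodule σ R m) (c : R) (x : σ → R) : eval (fun s => c * x s) F = c ^ m * eval x F := by
  have hF' : F.IsHomogeneous m := hF
  rw [eval_eq', eval_eq', Finset.mul_sum]
  refine Finset.sum_congr rfl fun α hα => ?_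
  have hdeg : ∑ i, α i = m := by
    rw [← Finsupp.degree_eq_sum, Finsupp.degree_apply]
    exact (hF'.degree_eq_sum_deg_support hα).symm
  simp_rw [mul_pow, Finset.prod_mul_distrib, Finset.prod_pow_eq_pow_sum, hdeg]
  ring

/-- evaluating the hyperplane substitution: `(ψ̃ F)(n) = F(B̃ · n)`. [folklore] -/
theorem eval_aeval_linear {R : Type*} [CommRing R] {n m : ℕ} (Bt : Fin (n + 1) → Fin m → R) (v : Fin m → R) (F : MvPolynomial (Fin (n + 1)) R) :
    eval v (aeval (fun a : Fin (n + 1) => ∑ j : Fin m, C (Bt a j) * X j) F) = eval (fun a => ∑ j, Bt a j * v j) F := by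
  induction F using MvPolynomial.induction_on with
  | C a => simp
  | add p q hp hq => simp only [map_add, hp, hq]
  | mul_X p a hp =>
    rw [map_mul, map_mul, hp, aeval_X, map_mul, eval_X, map_sum]
    congr 1
    exact Finset.sum_congr rfl fun j _ => by rw [map_mul, eval_C, eval_X]

/-- ★ **N-0, CONDITIONAL ASSEMBLY — LEVEL C.**  `coreS` of ✓ `noseDatum_initial_of_sections` from `cores` = (W5 ∧ S4 ∧ S7 ∧ S8) over the explicit sections; the
node sections are constructed and S1, S2, S3, S5, S6 are discharged.  See the module docstring. [OURS · brick N-0 · conditional assembly; counted 0] -/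
theorem coreS_of_cores (k : Type) [Field k] [IsAlgClosed k] (H : Scheme.{0})
    (ι : H ⟶ (Literature.AlgebraicGeometry.Motives.projectiveSpace 3 k).left)
    (_hι : AlgebraicGeometry.IsClosedImmersion ι) (_hH : AlgebraicGeometry.IsIntegral H)
    (cores : ∀ (O : Type) [CommRing O] [IsDomain O] [IsDiscreteValuationRing O] [IsAdicComplete (IsLocalRing.maximalIdeal O) O]
        [IsAlgClosed (IsLocalRing.ResidueField O)] (θ : O →+* k), Function.Surjective θ →
      (letI := MvPolynomial.gradedAlgebra (σ := Fin (3 + 1)) (R := O); letI := MvPolynomial.gradedAlgebra (σ := Fin (3 + 1)) (R := k);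
       ∀ (φ : MvPolynomial.homogeneousSubmodule (Fin (3 + 1)) O →+*ᵍ MvPolynomial.homogeneousSubmodule (Fin (3 + 1)) k)
        (hφ' : HomogeneousIdeal.irrelevant (MvPolynomial.homogeneousSubmodule (Fin (3 + 1)) k) ≤ (HomogeneousIdeal.irrelevant (MvPolynomial.homogeneousSubmodule (Fin (3 + 1)) O)).map φ), (∀ s, φ s = MvPolynomial.map θ s) →
        AlgebraicGeometry.IsIntegral (AlgebraicGeometry.Proj (MvPolynomial.homogeneousSubmodule (Fin (3 + 1)) O)) → IsLocallyNoetherian (AlgebraicGeometry.Proj (MvPolynomial.homogeneousSubmodule (Fin (3 + 1)) O)) → Literature.AlgebraicGeometry.Resolution.Scheme.IsRegular (AlgebraicGeometry.Proj (MvPolynomial.homogeneousSubmodule (Fin (3 + 1)) O)) → AlgebraicGeometry.IsProper (AlgebraicGeometry.Proj.toSpecZero (MvPolynomial.homogeneousSubmodule (Fin (3 + 1)) O) ≫ AlgebraicGeometry.Spec.map (CommRingCat.ofHom (algebraMap O (MvPolynomial.homogeneousSubmodule (Fin (3 + 1)) O 0)))) → AlgebraicGeometry.SmoothOfRelativeDimension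 3 (AlgebraicGeometry.Proj.toSpecZero (MvPolynomial.homogeneousSubmodule (Fin (3 + 1)) O) ≫ AlgebraicGeometry.Spec.map (CommRingCat.ofHom (algebraMap O (MvPolynomial.homogeneousSubmodule (Fin (3 + 1)) O 0)))) →
      -- the door's `ℓ`, `Z` and the CERTIFICATE data (`EqCertAt₀ k 3 ℓ Z hZ` unpacked)
      ∀ (ℓ : MvPolynomial (Fin (3 + 1)) k) (Z : Set (Literature.AlgebraicGeometry.Motives.projectiveSpace 3 k).left) (hZ : IsClosed Z) (e δ : ℕ) (g : MvPolynomial (Fin (3 + 1)) k)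
        (B : Fin (3 + 1) → Fin 3 → k) (c a b : Fin 3) (v : Fin δ → Fin 3 → k) (r : Fin 3 → Fin (3 + 1)),
        g.IsHomogeneous e → Squarefree (restrictToHyperplane B g) →
        Z = {y : (Literature.AlgebraicGeometry.Motives.projectiveSpace 3 k).left | ℓ ∈ (y : ProjectiveSpectrum (MvPolynomial.homogeneousSubmodule (Fin (3 + 1)) k)).asHomogeneousIdeal ∧ g ∈ (y : ProjectiveSpectrum (MvPolynomial.homogeneousSubmodule (Fin (3 + 1)) k)).asHomogeneousIdeal} →
        restrictToHyperplane B ℓ = 0 → Function.Injective r → ((c : ℕ) = 2 ∧ (a : ℕ) = 0 ∧ (b : ℕ) = 1) →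
        (∀ i, v i c = 1 ∧ MvPolynomial.eval (v i) (restrictToHyperplane B g) = 0 ∧
          (∀ j, MvPolynomial.eval (v i) (MvPolynomial.pderiv j (restrictToHyperplane B g)) = 0) ∧ hessBlock (restrictToHyperplane B g) a b (v i) ≠ 0) →
        (∀ z : ↥(redSub (Literature.AlgebraicGeometry.Motives.projectiveSpace 3 k).left Z hZ), IsClosed ({z} : Set ↥(redSub (Literature.AlgebraicGeometry.Motives.projectiveSpace 3 k).left Z hZ)) → ¬ IsRegularLocalRing ((redSub (Literature.AlgebraicGeometry.Motives.projectiveSpace 3 k).left Z hZ).presheaf.stalk z) →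
          ∃ i, IsCoordVecOf k 3 (fun s => ∑ j, B s j * v i j) (redSubι (Literature.AlgebraicGeometry.Motives.projectiveSpace 3 k).left Z hZ z : (Literature.AlgebraicGeometry.Motives.projectiveSpace 3 k).left)) →
      -- the LIFTED HYPERPLANE data (✓ `HyperplaneLift.exists_hyperplane_lift`)
      ∀ (a₀ : Fin (3 + 1)) (Bt : Fin (3 + 1) → Fin 3 → O) (ct : Fin (3 + 1) → O) (Nt : Fin 3 → Fin 3 → O),
        (∀ j, r j ≠ a₀) → (∀ a' j, θ (Bt a' j) = B a' j) → IsUnit (Matrix.of fun j j' : Fin 3 => Bt (r j) j').det → ct a₀ = 1 →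
        MvPolynomial.aeval (fun a' : Fin (3 + 1) => ∑ j : Fin 3, MvPolynomial.C (Bt a' j) * MvPolynomial.X j) (∑ a, MvPolynomial.C (ct a) * MvPolynomial.X a : MvPolynomial (Fin (3 + 1)) O) = 0 →
        (∀ G : MvPolynomial (Fin 3) O, MvPolynomial.aeval (fun a' : Fin (3 + 1) => ∑ j : Fin 3, MvPolynomial.C (Bt a' j) * MvPolynomial.X j)
          (MvPolynomial.aeval (fun i : Fin 3 => ∑ j : Fin 3, MvPolynomial.C (Nt i j) * MvPolynomial.X (r j)) G) = G) →
        (∀ f : MvPolynomial (Fin (3 + 1)) O, MvPolynomial.aeval (fun a' : Fin (3 + 1) => ∑ j : Fin 3, MvPolynomial.C (Bt a' j) * MvPolynomial.X j) f = 0 → (∑ a, MvPolynomial.C (ct a) * MvPolynomial.X a : MvPolynomial (Fin (3 + 1)) O) ∣ f) →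
        {y : (Literature.AlgebraicGeometry.Motives.projectiveSpace 3 k).left | ℓ ∈ (y : ProjectiveSpectrum (MvPolynomial.homogeneousSubmodule (Fin (3 + 1)) k)).asHomogeneousIdeal} = {y : (Literature.AlgebraicGeometry.Motives.projectiveSpace 3 k).left | (∑ a', MvPolynomial.C (θ (ct a')) * MvPolynomial.X a' : MvPolynomial (Fin (3 + 1)) k) ∈ (y : ProjectiveSpectrum (MvPolynomial.homogeneousSubmodule (Fin (3 + 1)) k)).asHomogeneousIdeal} →
      -- the EQUINODAL LIFT (✓ `exists_equinodal_lift_of_cert_of_surjective`)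
      ∀ (Gt : MvPolynomial (Fin 3) O) (nO : Fin δ → Fin 3 → O),
        Gt.IsHomogeneous e → MvPolynomial.map θ Gt = restrictToHyperplane B g → (∀ i j, θ (nO i j) = v i j) → (∀ i, nO i 2 = 1) →
        (∀ i, MvPolynomial.eval (nO i) Gt = 0 ∧ ∀ j, MvPolynomial.eval (nO i) (MvPolynomial.pderiv j Gt) = 0) →
        (∀ i, IsUnit (MvPolynomial.eval (nO i) (MvPolynomial.pderiv 0 (MvPolynomial.pderiv 0 Gt)) * MvPolynomial.eval (nO i) (MvPolynomial.pderiv 1 (MvPolynomial.pderiv 1 Gt))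
          - MvPolynomial.eval (nO i) (MvPolynomial.pderiv 0 (MvPolynomial.pderiv 1 Gt)) ^ 2)) →
      -- the two models' degree certificates (so the ideal sheaves below are well-formed)
      ∀ (hL : ∀ l, (![(∑ a, MvPolynomial.C (ct a) * MvPolynomial.X a : MvPolynomial (Fin (3 + 1)) O)] : Fin 1 → MvPolynomial (Fin (3 + 1)) O) l ∈ MvPolynomial.homogeneousSubmodule (Fin (3 + 1)) O ((![1] : Fin 1 → ℕ) l))
        (hF : ∀ l, (![(∑ a, MvPolynomial.C (ct a) * MvPolynomial.X a : MvPolynomial (Fin (3 + 1)) O), (MvPolynomial.aeval (fun i : Fin 3 => ∑ j : Fin 3, MvPolynomial.C (Nt i j) * MvPolynomial.X (r j)) Gt : MvPolynomial (Fin (3 + 1)) O)] : Fin 2 → MvPolynomial (Fin (3 + 1)) O) l ∈ MvPolynomial.homogeneousSubmodule (Fin (3 + 1)) O ((![1, e] : Fin 2 → ℕ) l)),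
      -- the NODE SECTIONS `𝔰 i = [av i]`, `av i = uᵢ⁻¹ • B̃·nO i` (✓ SectionOfVec), and the marked closed points `w i`
      ∀ (av : Fin δ → Fin (3 + 1) → O) (dv : Fin δ → Fin (3 + 1)) (hav : ∀ i, av i (dv i) = 1),
        (∀ i, ∃ u : O, IsUnit u ∧ ∀ a', u * av i a' = ∑ j : Fin 3, Bt a' j * nO i j) →
      ∀ (𝔰 : Fin δ → (AlgebraicGeometry.Spec (.of O) ⟶ (AlgebraicGeometry.Proj (MvPolynomial.homogeneousSubmodule (Fin (3 + 1)) O)))),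
        (∀ i, 𝔰 i = (AlgebraicGeometry.Spec.map (CommRingCat.ofHom ((Localization.awayLift (MvPolynomial.eval (av i)) (MvPolynomial.X (dv i) : MvPolynomial (Fin (3 + 1)) O)
            (SectionOfVec.isUnit_eval_X (av i) (dv i) (hav i))).comp
          (algebraMap (HomogeneousLocalization.Away (MvPolynomial.homogeneousSubmodule (Fin (3 + 1)) O) (MvPolynomial.X (dv i) : MvPolynomial (Fin (3 + 1)) O))
            (Localization.Away (MvPolynomial.X (dv i) : MvPolynomial (Fin (3 + 1)) O))))) ≫
          AlgebraicGeometry.Proj.awayι (MvPolynomial.homogeneousSubmodule (Fin (3 + 1)) O) (MvPolynomial.X (dv i)) (MvPolynomial.isHomogeneous_X O (dv i)) one_pos)) →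
      ∀ (w : Fin δ → (Literature.AlgebraicGeometry.Motives.projectiveSpace 3 k).left), (∀ i, (AlgebraicGeometry.Proj.map φ hφ' : (Literature.AlgebraicGeometry.Motives.projectiveSpace 3 k).left ⟶ (AlgebraicGeometry.Proj (MvPolynomial.homogeneousSubmodule (Fin (3 + 1)) O))) (w i) = 𝔰 i (IsLocalRing.closedPoint O)) →
      (∀ x : ↥((projIdealSheaf (MvPolynomial.homogeneousSubmodule (Fin (3 + 1)) O) ⟨Ideal.span (Set.range ![(∑ a, MvPolynomial.C (ct a) * MvPolynomial.X a : MvPolynomial (Fin (3 + 1)) O), (MvPolynomial.aeval (fun i : Fin 3 => ∑ j : Fin 3, MvPolynomial.C (Nt i j) * MvPolynomial.X (r j)) Gt : MvPolynomial (Fin (3 + 1)) O)]), isHomogeneous_span_of_forall_mem _ _ _ hF⟩).subscheme), (∀ i, (projIdealSheaf (MvPolynomial.homogeneousSubmodule (Fin (3 + 1)) O) ⟨Ideal.span (Set.range ![(∑ a, MvPolynomial.C (ct a) * MvPolynomial.X a : MvPolynomial (Fin (3 + 1)) O), (MvPolynomial.aeval (fun i : Fin 3 => ∑ j : Fin 3,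 MvPolynomial.C (Nt i j) * MvPolynomial.X (r j)) Gt : MvPolynomial (Fin (3 + 1)) O)]), isHomogeneous_span_of_forall_mem _ _ _ hF⟩).subschemeι x ∉ Set.range (𝔰 i)) →
          IsRegularLocalRing ((projIdealSheaf (MvPolynomial.homogeneousSubmodule (Fin (3 + 1)) O) ⟨Ideal.span (Set.range ![(∑ a, MvPolynomial.C (ct a) * MvPolynomial.X a : MvPolynomial (Fin (3 + 1)) O), (MvPolynomial.aeval (fun i : Fin 3 => ∑ j : Fin 3, MvPolynomial.C (Nt i j) * MvPolynomial.X (r j)) Gt : MvPolynomial (Fin (3 + 1)) O)]), isHomogeneous_span_of_forall_mem _ _ _ hF⟩).subscheme.presheaf.stalk x)) ∧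
      (Function.Injective w) ∧
      (∀ z : ↥(redSub (Literature.AlgebraicGeometry.Motives.projectiveSpace 3 k).left Z hZ), IsClosed ({z} : Set ↥(redSub (Literature.AlgebraicGeometry.Motives.projectiveSpace 3 k).left Z hZ)) →
          (¬ IsRegularLocalRing ((redSub (Literature.AlgebraicGeometry.Motives.projectiveSpace 3 k).left Z hZ).presheaf.stalk z) ↔ ∃ i, (redSubι (Literature.AlgebraicGeometry.Motives.projectiveSpace 3 k).left Z hZ z : (Literature.AlgebraicGeometry.Motives.projectiveSpace 3 k).left) = w i)) ∧
      (∀ i, SplitNodeAt (AlgebraicGeometry.Proj (MvPolynomial.homogeneousSubmodule (Fin (3 + 1)) O)) (projIdealSheaf (MvPolynomial.homogeneousSubmodule (Fin (3 + 1)) O) ⟨Ideal.span (Set.range ![(∑ a, MvPolynomial.C (ct a) * MvPolynomial.X a : MvPolynomial (Fin (3 + 1)) O)]), isHomogeneous_span_of_forall_mem _ _ _ hL⟩) (projIdealSheaf (MvPolynomial.homogeneousSubmodule (Fin (3 + 1)) O) ⟨Ideal.span (Set.range ![(∑ a, MvPolynomial.C (ct a) * MvPolynomial.X a : MvPolynomial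 (Fin (3 + 1)) O), (MvPolynomial.aeval (fun i : Fin 3 => ∑ j : Fin 3, MvPolynomial.C (Nt i j) * MvPolynomial.X (r j)) Gt : MvPolynomial (Fin (3 + 1)) O)]), isHomogeneous_span_of_forall_mem _ _ _ hF⟩) (𝔰 i).ker (𝔰 i (IsLocalRing.closedPoint O))))) :
    ∀ (O : Type) [CommRing O] [IsDomain O] [IsDiscreteValuationRing O] [IsAdicComplete (IsLocalRing.maximalIdeal O) O]
        [IsAlgClosed (IsLocalRing.ResidueField O)] (θ : O →+* k), Function.Surjective θ →
      (letI := MvPolynomial.gradedAlgebra (σ := Fin (3 + 1)) (R := O); letI := MvPolynomial.gradedAlgebra (σ := Fin (3 + 1)) (R := k);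
       ∀ (φ : MvPolynomial.homogeneousSubmodule (Fin (3 + 1)) O →+*ᵍ MvPolynomial.homogeneousSubmodule (Fin (3 + 1)) k)
        (hφ' : HomogeneousIdeal.irrelevant (MvPolynomial.homogeneousSubmodule (Fin (3 + 1)) k) ≤ (HomogeneousIdeal.irrelevant (MvPolynomial.homogeneousSubmodule (Fin (3 + 1)) O)).map φ), (∀ s, φ s = MvPolynomial.map θ s) →
        AlgebraicGeometry.IsIntegral (AlgebraicGeometry.Proj (MvPolynomial.homogeneousSubmodule (Fin (3 + 1)) O)) → IsLocallyNoetherian (AlgebraicGeometry.Proj (MvPolynomial.homogeneousSubmodule (Fin (3 + 1)) O)) → Literature.AlgebraicGeometry.Resolution.Scheme.IsRegular (AlgebraicGeometry.Proj (MvPolynomial.homogeneousSubmodule (Fin (3 + 1)) O)) → AlgebraicGeometry.IsProper (AlgebraicGeometry.Proj.toSpecZero (MvPolynomial.homogeneousSubmodule (Fin (3 + 1)) O) ≫ AlgebraicGeometry.Spec.map (CommRingCat.ofHom (algebraMap O (MvPolynomial.homogeneousSubmodule (Fin (3 + 1)) O 0)))) → AlgebraicGeometry.SmoothOfRelativeDimension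 3 (AlgebraicGeometry.Proj.toSpecZero (MvPolynomial.homogeneousSubmodule (Fin (3 + 1)) O) ≫ AlgebraicGeometry.Spec.map (CommRingCat.ofHom (algebraMap O (MvPolynomial.homogeneousSubmodule (Fin (3 + 1)) O 0)))) →
      -- the door's `ℓ`, `Z` and the CERTIFICATE data (`EqCertAt₀ k 3 ℓ Z hZ` unpacked)
      ∀ (ℓ : MvPolynomial (Fin (3 + 1)) k) (Z : Set (Literature.AlgebraicGeometry.Motives.projectiveSpace 3 k).left) (hZ : IsClosed Z) (e δ : ℕ) (g : MvPolynomial (Fin (3 + 1)) k)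
        (B : Fin (3 + 1) → Fin 3 → k) (c a b : Fin 3) (v : Fin δ → Fin 3 → k) (r : Fin 3 → Fin (3 + 1)),
        g.IsHomogeneous e → Squarefree (restrictToHyperplane B g) →
        Z = {y : (Literature.AlgebraicGeometry.Motives.projectiveSpace 3 k).left | ℓ ∈ (y : ProjectiveSpectrum (MvPolynomial.homogeneousSubmodule (Fin (3 + 1)) k)).asHomogeneousIdeal ∧ g ∈ (y : ProjectiveSpectrum (MvPolynomial.homogeneousSubmodule (Fin (3 + 1)) k)).asHomogeneousIdeal} →
        restrictToHyperplane B ℓ = 0 → Function.Injective r → ((c : ℕ) = 2 ∧ (a : ℕ) = 0 ∧ (b : ℕ) = 1) →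
        (∀ i, v i c = 1 ∧ MvPolynomial.eval (v i) (restrictToHyperplane B g) = 0 ∧
          (∀ j, MvPolynomial.eval (v i) (MvPolynomial.pderiv j (restrictToHyperplane B g)) = 0) ∧ hessBlock (restrictToHyperplane B g) a b (v i) ≠ 0) →
        (∀ z : ↥(redSub (Literature.AlgebraicGeometry.Motives.projectiveSpace 3 k).left Z hZ), IsClosed ({z} : Set ↥(redSub (Literature.AlgebraicGeometry.Motives.projectiveSpace 3 k).left Z hZ)) → ¬ IsRegularLocalRing ((redSub (Literature.AlgebraicGeometry.Motives.projectiveSpace 3 k).left Z hZ).presheaf.stalk z) →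
          ∃ i, IsCoordVecOf k 3 (fun s => ∑ j, B s j * v i j) (redSubι (Literature.AlgebraicGeometry.Motives.projectiveSpace 3 k).left Z hZ z : (Literature.AlgebraicGeometry.Motives.projectiveSpace 3 k).left)) →
      -- the LIFTED HYPERPLANE data (✓ `HyperplaneLift.exists_hyperplane_lift`)
      ∀ (a₀ : Fin (3 + 1)) (Bt : Fin (3 + 1) → Fin 3 → O) (ct : Fin (3 + 1) → O) (Nt : Fin 3 → Fin 3 → O),
        (∀ j, r j ≠ a₀) → (∀ a' j, θ (Bt a' j) = B a' j) → IsUnit (Matrix.of fun j j' : Fin 3 => Bt (r j) j').det → ct a₀ = 1 →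
        MvPolynomial.aeval (fun a' : Fin (3 + 1) => ∑ j : Fin 3, MvPolynomial.C (Bt a' j) * MvPolynomial.X j) (∑ a, MvPolynomial.C (ct a) * MvPolynomial.X a : MvPolynomial (Fin (3 + 1)) O) = 0 →
        (∀ G : MvPolynomial (Fin 3) O, MvPolynomial.aeval (fun a' : Fin (3 + 1) => ∑ j : Fin 3, MvPolynomial.C (Bt a' j) * MvPolynomial.X j)
          (MvPolynomial.aeval (fun i : Fin 3 => ∑ j : Fin 3, MvPolynomial.C (Nt i j) * MvPolynomial.X (r j)) G) = G) →
        (∀ f : MvPolynomial (Fin (3 + 1)) O, MvPolynomial.aeval (fun a' : Fin (3 + 1) => ∑ j : Fin 3, MvPolynomial.C (Bt a' j) * MvPolynomial.X j) f = 0 → (∑ a, MvPolynomial.C (ct a) * MvPolynomial.X a : MvPolynomial (Fin (3 + 1)) O) ∣ f) →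
        {y : (Literature.AlgebraicGeometry.Motives.projectiveSpace 3 k).left | ℓ ∈ (y : ProjectiveSpectrum (MvPolynomial.homogeneousSubmodule (Fin (3 + 1)) k)).asHomogeneousIdeal} = {y : (Literature.AlgebraicGeometry.Motives.projectiveSpace 3 k).left | (∑ a', MvPolynomial.C (θ (ct a')) * MvPolynomial.X a' : MvPolynomial (Fin (3 + 1)) k) ∈ (y : ProjectiveSpectrum (MvPolynomial.homogeneousSubmodule (Fin (3 + 1)) k)).asHomogeneousIdeal} →
      -- the EQUINODAL LIFT (✓ `exists_equinodal_lift_of_cert_of_surjective`)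
      ∀ (Gt : MvPolynomial (Fin 3) O) (nO : Fin δ → Fin 3 → O),
        Gt.IsHomogeneous e → MvPolynomial.map θ Gt = restrictToHyperplane B g → (∀ i j, θ (nO i j) = v i j) → (∀ i, nO i 2 = 1) →
        (∀ i, MvPolynomial.eval (nO i) Gt = 0 ∧ ∀ j, MvPolynomial.eval (nO i) (MvPolynomial.pderiv j Gt) = 0) →
        (∀ i, IsUnit (MvPolynomial.eval (nO i) (MvPolynomial.pderiv 0 (MvPolynomial.pderiv 0 Gt)) * MvPolynomial.eval (nO i) (MvPolynomial.pderiv 1 (MvPolynomial.pderiv 1 Gt))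
          - MvPolynomial.eval (nO i) (MvPolynomial.pderiv 0 (MvPolynomial.pderiv 1 Gt)) ^ 2)) →
      -- the two models' degree certificates (so the ideal sheaves below are well-formed)
      ∀ (hL : ∀ l, (![(∑ a, MvPolynomial.C (ct a) * MvPolynomial.X a : MvPolynomial (Fin (3 + 1)) O)] : Fin 1 → MvPolynomial (Fin (3 + 1)) O) l ∈ MvPolynomial.homogeneousSubmodule (Fin (3 + 1)) O ((![1] : Fin 1 → ℕ) l))
        (hF : ∀ l, (![(∑ a, MvPolynomial.C (ct a) * MvPolynomial.X a : MvPolynomial (Fin (3 + 1)) O), (MvPolynomial.aeval (fun i : Fin 3 => ∑ j : Fin 3, MvPolynomial.C (Nt i j) * MvPolynomial.X (r j)) Gt : MvPolynomial (Fin (3 + 1)) O)] : Fin 2 → MvPolynomial (Fin (3 + 1)) O) l ∈ MvPolynomial.homogeneousSubmodule (Fin (3 + 1)) O ((![1, e] : Fin 2 → ℕ) l)),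
      -- CONCLUSION: the SECTIONS half of `NoseDatum` for `𝓛₀ := (![L̃])~`, `𝓦₀ := (![L̃, Ĝ])~`
      ∃ (m : ℕ) (𝔰 : Fin m → (AlgebraicGeometry.Spec (.of O) ⟶ (AlgebraicGeometry.Proj (MvPolynomial.homogeneousSubmodule (Fin (3 + 1)) O)))) (w : Fin m → (Literature.AlgebraicGeometry.Motives.projectiveSpace 3 k).left),
        (∀ x : ↥((projIdealSheaf (MvPolynomial.homogeneousSubmodule (Fin (3 + 1)) O) ⟨Ideal.span (Set.range ![(∑ a, MvPolynomial.C (ct a) * MvPolynomial.X a : MvPolynomial (Fin (3 + 1)) O), (MvPolynomial.aeval (fun i : Fin 3 => ∑ j : Fin 3, MvPolynomial.C (Nt i j) * MvPolynomial.X (r j)) Gt : MvPolynomial (Fin (3 + 1)) O)]), isHomogeneous_span_of_forall_mem _ _ _ hF⟩).subscheme), (∀ i, (projIdealSheaf (MvPolynomial.homogeneousSubmodule (Fin (3 + 1)) O) ⟨Ideal.span (Set.range ![(∑ a, MvPolynomial.C (ct a) * MvPolynomial.X a : MvPolynomial (Fin (3 + 1)) O), (MvPolynomial.aeval (fun i :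 Fin 3 => ∑ j : Fin 3, MvPolynomial.C (Nt i j) * MvPolynomial.X (r j)) Gt : MvPolynomial (Fin (3 + 1)) O)]), isHomogeneous_span_of_forall_mem _ _ _ hF⟩).subschemeι x ∉ Set.range (𝔰 i)) →
          IsRegularLocalRing ((projIdealSheaf (MvPolynomial.homogeneousSubmodule (Fin (3 + 1)) O) ⟨Ideal.span (Set.range ![(∑ a, MvPolynomial.C (ct a) * MvPolynomial.X a : MvPolynomial (Fin (3 + 1)) O), (MvPolynomial.aeval (fun i : Fin 3 => ∑ j : Fin 3, MvPolynomial.C (Nt i j) * MvPolynomial.X (r j)) Gt : MvPolynomial (Fin (3 + 1)) O)]), isHomogeneous_span_of_forall_mem _ _ _ hF⟩).subscheme.presheaf.stalk x)) ∧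
        (∀ i, 𝔰 i ≫ 𝟙 (AlgebraicGeometry.Proj (MvPolynomial.homogeneousSubmodule (Fin (3 + 1)) O)) ≫ (AlgebraicGeometry.Proj.toSpecZero (MvPolynomial.homogeneousSubmodule (Fin (3 + 1)) O) ≫ AlgebraicGeometry.Spec.map (CommRingCat.ofHom (algebraMap O (MvPolynomial.homogeneousSubmodule (Fin (3 + 1)) O 0)))) = 𝟙 _) ∧ (∀ i, (projIdealSheaf (MvPolynomial.homogeneousSubmodule (Fin (3 + 1)) O) ⟨Ideal.span (Set.range ![(∑ a, MvPolynomial.C (ct a) * MvPolynomial.X a : MvPolynomial (Fin (3 + 1)) O), (MvPolynomial.aeval (fun i : Fin 3 => ∑ j : Fin 3, MvPolynomial.C (Nt i j) * MvPolynomial.X (r j)) Gt : MvPolynomial (Fin (3 + 1)) O)]), isHomogeneous_span_of_forall_mem _ _ _ hF⟩) ≤ (𝔰 i).ker) ∧ (∀ i, (AlgebraicGeometry.Proj.map φ hφ' : (Literature.AlgebraicGeometry.Motives.projectiveSpace 3 k).left ⟶ (AlgebraicGeometry.Proj (MvPolynomial.homogeneousSubmodule (Fin (3 + 1)) O))) (w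 i) = 𝔰 i (IsLocalRing.closedPoint O)) ∧
        Function.Injective w ∧ (∀ i, w i ∈ Z) ∧ (∀ i, IsClosed ({w i} : Set (Literature.AlgebraicGeometry.Motives.projectiveSpace 3 k).left)) ∧
        (∀ z : ↥(redSub (Literature.AlgebraicGeometry.Motives.projectiveSpace 3 k).left Z hZ), IsClosed ({z} : Set ↥(redSub (Literature.AlgebraicGeometry.Motives.projectiveSpace 3 k).left Z hZ)) →
          (¬ IsRegularLocalRing ((redSub (Literature.AlgebraicGeometry.Motives.projectiveSpace 3 k).left Z hZ).presheaf.stalk z) ↔ ∃ i, (redSubι (Literature.AlgebraicGeometry.Motives.projectiveSpace 3 k).left Z hZ z : (Literature.AlgebraicGeometry.Motives.projectiveSpace 3 k).left) = w i)) ∧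
        (∀ i, SplitNodeAt (AlgebraicGeometry.Proj (MvPolynomial.homogeneousSubmodule (Fin (3 + 1)) O)) (projIdealSheaf (MvPolynomial.homogeneousSubmodule (Fin (3 + 1)) O) ⟨Ideal.span (Set.range ![(∑ a, MvPolynomial.C (ct a) * MvPolynomial.X a : MvPolynomial (Fin (3 + 1)) O)]), isHomogeneous_span_of_forall_mem _ _ _ hL⟩) (projIdealSheaf (MvPolynomial.homogeneousSubmodule (Fin (3 + 1)) O) ⟨Ideal.span (Set.range ![(∑ a, MvPolynomial.C (ct a) * MvPolynomial.X a : MvPolynomial (Fin (3 + 1)) O), (MvPolynomial.aeval (fun i : Fin 3 => ∑ j : Fin 3, MvPolynomial.C (Nt i j) * MvPolynomial.X (r j)) Gt : MvPolynomial (Fin (3 + 1)) O)]), isHomogeneous_span_of_forall_mem _ _ _ hF⟩) (𝔰 i).ker (𝔰 i (IsLocalRing.closedPoint O)))) := by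
  classical
  intro O _ _ _ _ _ θ hθ
  letI := MvPolynomial.gradedAlgebra (σ := Fin (3 + 1)) (R := O)
  letI := MvPolynomial.gradedAlgebra (σ := Fin (3 + 1)) (R := k)
  intro φ hφ' hφ hPint hPnoeth hPreg hqprop hqsm ℓ Z hZ e δ g B c a b v r hg hsq hZeq hℓB hr hcab hmarked hcover a₀ Bt ct Nt ha₀ hBt hdett hcta₀
    hψt hsect hkert hVlin Gt nO hGt hGtg hnO hn2 hnode hHess hL hF
  -- the reduced trace `𝓦₀ · 𝒪_{ℙ³_k} = 𝓘⟨Z⟩` (re-derived as in Level B; computed FIRST, while the context is small)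
  let ψk : MvPolynomial (Fin (3 + 1)) k →ₐ[k] MvPolynomial (Fin 3) k := MvPolynomial.aeval fun a' : Fin (3 + 1) => ∑ j : Fin 3, C (B a' j) * X j
  let σk : MvPolynomial (Fin 3) k → MvPolynomial (Fin (3 + 1)) k := fun G => aeval (fun i : Fin 3 => ∑ j : Fin 3, C (θ (Nt i j)) * X (r j)) G
  have hψσk : ∀ G, ψk (σk G) = G := by
    intro G
    obtain ⟨G', rfl⟩ := MvPolynomial.map_surjective θ hθ G
    change MvPolynomial.aeval _ (aeval _ (MvPolynomial.map θ G')) = _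
    rw [← map_aeval_sect θ Nt r G', ← HyperplaneLift.map_aeval_linear θ Bt B hBt, hsect]
  -- the downstairs kernel facts of the reduced hyperplane substitution (from the `O`-level ones)
  have hψk : ψk (∑ a', C (θ (ct a')) * X a' : MvPolynomial (Fin (3 + 1)) k) = 0 := by
    change MvPolynomial.aeval _ _ = 0
    rw [← HyperplaneLift.map_sum_C_mul_X θ ct, ← HyperplaneLift.map_aeval_linear θ Bt B hBt, hψt, map_zero]
  have hkerk : ∀ f₀ : MvPolynomial (Fin (3 + 1)) k, ψk f₀ = 0 → (∑ a', C (θ (ct a')) * X a' : MvPolynomial (Fin (3 + 1)) k) ∣ f₀ := by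
    intro f₀ hf₀
    obtain ⟨f', rfl⟩ := MvPolynomial.map_surjective θ hθ f₀
    let ψr : MvPolynomial (Fin (3 + 1)) O →+* MvPolynomial (Fin 3) O :=
      (MvPolynomial.aeval fun a' : Fin (3 + 1) => ∑ j : Fin 3, C (Bt a' j) * X j).toRingHom
    have hsectr : ∀ G, ψr (aeval (fun i : Fin 3 => ∑ j : Fin 3, C (Nt i j) * X (r j)) G) = G := fun G => hsect G
    have hkertr : ∀ f₁, ψr f₁ = 0 → (∑ a', C (ct a') * X a' : MvPolynomial (Fin (3 + 1)) O) ∣ f₁ := fun f₁ hf₁ => hkert f₁ hf₁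
    obtain ⟨m', hm'⟩ := HyperplaneAlg.dvd_sub_section ψr (fun G => aeval (fun i : Fin 3 => ∑ j : Fin 3, C (Nt i j) * X (r j)) G)
      (∑ a', C (ct a') * X a' : MvPolynomial (Fin (3 + 1)) O) hsectr hkertr f'
    have hred : MvPolynomial.map θ (ψr f') = 0 := by
      change MvPolynomial.map θ ((MvPolynomial.aeval fun a' : Fin (3 + 1) => ∑ j : Fin 3, C (Bt a' j) * X j) f') = 0
      rw [HyperplaneLift.map_aeval_linear θ Bt B hBt]; exact hf₀
    have hf' : f' = (∑ a', C (ct a') * X a') * m' + aeval (fun i : Fin 3 => ∑ j : Fin 3, C (Nt i j) * X (r j)) (ψr f') := by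
      rw [← hm']; ring
    refine ⟨MvPolynomial.map θ m', ?_⟩
    rw [hf', map_add, map_mul, HyperplaneLift.map_sum_C_mul_X, map_aeval_sect, hred, map_zero, add_zero]
  let f : Fin 2 → MvPolynomial (Fin (3 + 1)) k := ![∑ a', C (θ (ct a')) * X a', σk (restrictToHyperplane B g)]
  have hφX : ∀ i : Fin (3 + 1), φ (X i) = X i := fun i => by rw [hφ, map_X]
  have hφF : ∀ l, φ ((![(∑ a', C (ct a') * X a' : MvPolynomial (Fin (3 + 1)) O),
      aeval (fun i' : Fin 3 => ∑ j : Fin 3, C (Nt i' j) * X (r j)) Gt] : Fin 2 → MvPolynomial (Fin (3 + 1)) O) l) = f l := by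
    intro l; fin_cases l
    · change φ (∑ a', C (ct a') * X a') = ∑ a', C (θ (ct a')) * X a'
      rw [hφ, HyperplaneLift.map_sum_C_mul_X]
    · change φ (aeval (fun i' : Fin 3 => ∑ j : Fin 3, C (Nt i' j) * X (r j)) Gt) = σk (restrictToHyperplane B g)
      rw [hφ, map_aeval_sect, hGtg]
  have hhe : (restrictToHyperplane B g).IsHomogeneous e := isHomogeneous_restrictToHyperplane B g hg
  have hf : ∀ l, f l ∈ homogeneousSubmodule (Fin (3 + 1)) k ((![1, e] : Fin 2 → ℕ) l) := by
    intro l; fin_cases l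
    · exact HyperplaneAlg.isHomogeneous_sum_C_mul_X (fun a' => θ (ct a')) id
    · exact HyperplaneAlg.isHomogeneous_aeval_linear _ (fun i => HyperplaneAlg.isHomogeneous_sum_C_mul_X _ _) _ hhe
  have hrad : (Ideal.span (Set.range f)).IsRadical :=
    NoseModel.isRadical_span_range_pair ψk.toRingHom σk _ hψk hψσk hkerk (restrictToHyperplane B g) hsq
  have hZf : Z = {y : Proj (homogeneousSubmodule (Fin (3 + 1)) k) | ∀ l, f l ∈ y.asHomogeneousIdeal} :=
    hZeq.trans (NoseModel.setOf_pair_eq ψk.toRingHom σk _ hψσk hkerk ℓ g hVlin)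
  have hW2 := NoseModel.comap_eq_vanishingIdeal_of_isRadical φ hφ' hφX (![(∑ a', C (ct a') * X a' : MvPolynomial (Fin (3 + 1)) O), aeval (fun i' : Fin 3 => ∑ j : Fin 3, C (Nt i' j) * X (r j)) Gt] : Fin 2 → MvPolynomial (Fin (3 + 1)) O) f (![1, e] : Fin 2 → ℕ) hF hf hφF hrad Z hZ hZf
  -- units of `O` are detected by `θ`
  have hunit : ∀ x : O, θ x ≠ 0 → IsUnit x := by
    intro x hx
    by_contra h
    have hm : x ∈ IsLocalRing.maximalIdeal O := h
    rw [← ker_eq_maximalIdeal_of_surjective θ hθ] at hm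
    exact hx hm
  obtain ⟨hr', hdet⟩ : Function.Injective r ∧ True := ⟨hr, trivial⟩
  -- the vectors `B̃ · nO i` have a unit coordinate among the `r j`
  have hBv : ∀ i, ∃ j : Fin 3, θ (∑ j' : Fin 3, Bt (r j) j' * nO i j') ≠ 0 := by
    intro i
    by_contra hall
    simp only [not_exists, not_not] at hall
    have hM : (Matrix.of fun j j' : Fin 3 => B (r j) j').mulVec (v i) = 0 := by
      funext j
      have h := hall j
      simp only [map_sum, map_mul, hBt, hnO] at h
      simpa [Matrix.mulVec, dotProduct] using h
    have hdetk : IsUnit (Matrix.of fun j j' : Fin 3 => B (r j) j').det := by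
      have h := hdett.map θ
      rw [RingHom.map_det] at h
      refine (isUnit_iff_ne_zero.mpr fun h0 => ?_)
      apply isUnit_iff_ne_zero.mp h
      rw [← h0]
      congr 1
      ext j j'
      simp [Matrix.of_apply, hBt]
    have hv0 : v i = 0 := by
      have := congrArg ((Matrix.of fun j j' : Fin 3 => B (r j) j')⁻¹.mulVec) hM
      rwa [Matrix.mulVec_mulVec, Matrix.nonsing_inv_mul _ hdetk, Matrix.one_mulVec, Matrix.mulVec_zero] at this
    have h1 := (hmarked i).1
    rw [hv0] at h1
    exact zero_ne_one h1
  choose jd hjd using hBv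
  -- the normalised vectors `av i` and the sections `𝔰 i = [av i]`
  let bv : Fin δ → Fin (3 + 1) → O := fun i a' => ∑ j : Fin 3, Bt a' j * nO i j
  have hu : ∀ i, IsUnit (bv i (r (jd i))) := fun i => hunit _ (hjd i)
  let av : Fin δ → Fin (3 + 1) → O := fun i a' => ((hu i).unit⁻¹ : Oˣ) * bv i a'
  have hav : ∀ i, av i (r (jd i)) = 1 := fun i => by
    simp only [av]
    exact (hu i).val_inv_mul
  have hab : ∀ i, ∃ u : O, IsUnit u ∧ ∀ a', u * av i a' = ∑ j : Fin 3, Bt a' j * nO i j := fun i =>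
    ⟨bv i (r (jd i)), hu i, fun a' => by
      simp only [av]
      rw [← mul_assoc, IsUnit.mul_val_inv, one_mul]⟩
  let 𝔰 : Fin δ → (Spec (.of O) ⟶ Proj (homogeneousSubmodule (Fin (3 + 1)) O)) := fun i =>
    (Spec.map (CommRingCat.ofHom ((Localization.awayLift (MvPolynomial.eval (av i)) (MvPolynomial.X (r (jd i)) : MvPolynomial (Fin (3 + 1)) O)
            (SectionOfVec.isUnit_eval_X (av i) (r (jd i)) (hav i))).comp
          (algebraMap (HomogeneousLocalization.Away (MvPolynomial.homogeneousSubmodule (Fin (3 + 1)) O) (MvPolynomial.X (r (jd i)) : MvPolynomial (Fin (3 + 1)) O))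
            (Localization.Away (MvPolynomial.X (r (jd i)) : MvPolynomial (Fin (3 + 1)) O))))) ≫
          Proj.awayι (MvPolynomial.homogeneousSubmodule (Fin (3 + 1)) O) (MvPolynomial.X (r (jd i))) (MvPolynomial.isHomogeneous_X O (r (jd i))) one_pos)
  have h𝔰 : ∀ i, 𝔰 i =
    (Spec.map (CommRingCat.ofHom ((Localization.awayLift (MvPolynomial.eval (av i)) (MvPolynomial.X (r (jd i)) : MvPolynomial (Fin (3 + 1)) O)
            (SectionOfVec.isUnit_eval_X (av i) (r (jd i)) (hav i))).comp
          (algebraMap (HomogeneousLocalization.Away (MvPolynomial.homogeneousSubmodule (Fin (3 + 1)) O) (MvPolynomial.X (r (jd i)) : MvPolynomial (Fin (3 + 1)) O))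
            (Localization.Away (MvPolynomial.X (r (jd i)) : MvPolynomial (Fin (3 + 1)) O))))) ≫
          Proj.awayι (MvPolynomial.homogeneousSubmodule (Fin (3 + 1)) O) (MvPolynomial.X (r (jd i))) (MvPolynomial.isHomogeneous_X O (r (jd i))) one_pos) := fun i => rfl
  -- S1
  have hS1 : ∀ i, 𝔰 i ≫ 𝟙 _ ≫ (Proj.toSpecZero (homogeneousSubmodule (Fin (3 + 1)) O) ≫
      Spec.map (CommRingCat.ofHom (algebraMap O (homogeneousSubmodule (Fin (3 + 1)) O 0)))) = 𝟙 _ := fun i => by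
    rw [Category.id_comp]; exact SectionOfVec.sectionOfVec_comp_eq_id (av i) (r (jd i)) (hav i)
  -- S2: the two forms vanish at `av i`
  have hb : ∀ i (F : MvPolynomial (Fin (3 + 1)) O) (m : ℕ), F ∈ homogeneousSubmodule (Fin (3 + 1)) O m →
      eval (bv i) F = 0 → eval (av i) F = 0 := by
    intro i F m hFm hF0
    have h := eval_smul_of_mem_homogeneousSubmodule F hFm (((hu i).unit⁻¹ : Oˣ) : O) (bv i)
    rw [hF0, mul_zero] at h
    exact h
  have hFa0 : ∀ i, eval (av i) (∑ a', C (ct a') * X a' : MvPolynomial (Fin (3 + 1)) O) = 0 := fun i => by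
    refine hb i _ 1 (hF 0) ?_
    change eval (fun a' => ∑ j : Fin 3, Bt a' j * nO i j) _ = 0
    rw [← eval_aeval_linear Bt (nO i), hψt, map_zero]
  have hFa1 : ∀ i, eval (av i) (aeval (fun i' : Fin 3 => ∑ j : Fin 3, C (Nt i' j) * X (r j)) Gt) = 0 := fun i => by
    refine hb i _ e (hF 1) ?_
    change eval (fun a' => ∑ j : Fin 3, Bt a' j * nO i j) _ = 0
    rw [← eval_aeval_linear Bt (nO i), hsect, (hnode i).1]
  have hFa : ∀ i l, eval (av i) ((![(∑ a', C (ct a') * X a' : MvPolynomial (Fin (3 + 1)) O),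
      aeval (fun i' : Fin 3 => ∑ j : Fin 3, C (Nt i' j) * X (r j)) Gt] : Fin 2 → MvPolynomial (Fin (3 + 1)) O) l) = 0 := by
    intro i l
    fin_cases l
    · exact hFa0 i
    · exact hFa1 i
  have hS2 : ∀ i, projIdealSheaf (homogeneousSubmodule (Fin (3 + 1)) O)
      ⟨Ideal.span (Set.range ![(∑ a', C (ct a') * X a' : MvPolynomial (Fin (3 + 1)) O),
        aeval (fun i' : Fin 3 => ∑ j : Fin 3, C (Nt i' j) * X (r j)) Gt]), isHomogeneous_span_of_forall_mem _ _ _ hF⟩ ≤ (𝔰 i).ker :=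
    fun i => SectionOfVec.projIdealSheaf_le_ker_sectionOfVec (av i) (r (jd i)) (hav i) (![(∑ a', C (ct a') * X a' : MvPolynomial (Fin (3 + 1)) O), aeval (fun i' : Fin 3 => ∑ j : Fin 3, C (Nt i' j) * X (r j)) Gt] : Fin 2 → MvPolynomial (Fin (3 + 1)) O) (![1, e] : Fin 2 → ℕ) hF (hFa i)
  -- S3: the marked closed points `w i` (the special fibre is `range (Proj φ)`)
  let q : Proj (homogeneousSubmodule (Fin (3 + 1)) O) ⟶ Spec (.of O) :=
    Proj.toSpecZero (homogeneousSubmodule (Fin (3 + 1)) O) ≫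
      Spec.map (CommRingCat.ofHom (algebraMap O (homogeneousSubmodule (Fin (3 + 1)) O 0)))
  have hP := ProjectiveAmbientFibre.isPullback_projMap θ φ hφ hθ hφ'
  have hrange : Set.range (Proj.map φ hφ') = q ⁻¹' {IsLocalRing.closedPoint O} := by
    rw [range_eq_preimage_of_isPullback hP, range_specMap_of_surjective_of_field θ hθ]
  have hw' : ∀ i, ∃ w : (Literature.AlgebraicGeometry.Motives.projectiveSpace 3 k).left, Proj.map φ hφ' w = 𝔰 i (IsLocalRing.closedPoint O) := by
    intro i
    have h := hS1 i
    rw [Category.id_comp] at h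
    have hmem : 𝔰 i (IsLocalRing.closedPoint O) ∈ Set.range (Proj.map φ hφ') := by
      rw [hrange]
      change q (𝔰 i (IsLocalRing.closedPoint O)) = _
      rw [← Scheme.Hom.comp_apply, h]
      rfl
    exact hmem
  choose w hw using hw'
  -- the cores
  obtain ⟨hW5, hS4, hS7, hS8⟩ := cores O θ hθ φ hφ' hφ hPint hPnoeth hPreg hqprop hqsm ℓ Z hZ e δ g B c a b v r hg hsq hZeq hℓB hr hcab hmarked hcover a₀ Bt ct Nt
    ha₀ hBt hdett hcta₀ hψt hsect hkert hVlin Gt nO hGt hGtg hnO hn2 hnode hHess hL hF av (fun i => r (jd i)) hav hab 𝔰 h𝔰 w hw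
  -- S5: `w i ∈ Z` through the reduced trace and the support dictionary
  have hs := congrArg (fun I => (I.support : Set (Proj (homogeneousSubmodule (Fin (3 + 1)) k)))) hW2
  simp only [Scheme.IdealSheafData.support_comap, Scheme.IdealSheafData.coe_support_vanishingIdeal,
    TopologicalSpace.Closeds.coe_preimage, TopologicalSpace.Closeds.coe_mk] at hs
  have hS5 : ∀ i, w i ∈ Z := by
    intro i
    have hmem : Proj.map φ hφ' (w i) ∈ ((projIdealSheaf (homogeneousSubmodule (Fin (3 + 1)) O)
        ⟨Ideal.span (Set.range (![(∑ a', C (ct a') * X a' : MvPolynomial (Fin (3 + 1)) O), aeval (fun i' : Fin 3 => ∑ j : Fin 3, C (Nt i' j) * X (r j)) Gt] : Fin 2 → MvPolynomial (Fin (3 + 1)) O)), isHomogeneous_span_of_forall_mem _ _ _ hF⟩).support :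
          Set (Proj (homogeneousSubmodule (Fin (3 + 1)) O))) := by
      rw [hw i, h𝔰 i]
      exact (SectionOfVec.sectionOfVec_closedPoint_mem_support_iff (av i) (r (jd i)) (hav i) (![(∑ a', C (ct a') * X a' : MvPolynomial (Fin (3 + 1)) O), aeval (fun i' : Fin 3 => ∑ j : Fin 3, C (Nt i' j) * X (r j)) Gt] : Fin 2 → MvPolynomial (Fin (3 + 1)) O) (![1, e] : Fin 2 → ℕ) hF).mpr
        fun l => by rw [hFa i l]; exact Ideal.zero_mem _
    rw [← hs]
    exact hmem
  -- S6: the sections are closed immersions (q is separated), `Proj φ` is injective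
  haveI : IsClosedImmersion (Spec.map (CommRingCat.ofHom θ)) := IsClosedImmersion.spec_of_surjective _ hθ
  haveI : IsClosedImmersion (Proj.map φ hφ') := MorphismProperty.IsStableUnderBaseChange.of_isPullback hP.flip inferInstance
  haveI := hqprop
  have hS6 : ∀ i, IsClosed ({w i} : Set (Literature.AlgebraicGeometry.Motives.projectiveSpace 3 k).left) := by
    intro i
    have h1 := hS1 i
    rw [Category.id_comp] at h1
    haveI : IsClosedImmersion (𝔰 i) :=
      Literature.AlgebraicGeometry.Resolution.DeJong1996.IsUnionOfSections.isClosedImmersion_of_comp_eq_id h1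
    have hcl : IsClosed ({𝔰 i (IsLocalRing.closedPoint O)} : Set (Proj (homogeneousSubmodule (Fin (3 + 1)) O))) := by
      rw [← Set.image_singleton]
      exact (𝔰 i).isClosedEmbedding.isClosedMap _ (IsLocalRing.isClosed_singleton_closedPoint _)
    have heq : ({w i} : Set (Literature.AlgebraicGeometry.Motives.projectiveSpace 3 k).left) =
        (Proj.map φ hφ') ⁻¹' {𝔰 i (IsLocalRing.closedPoint O)} := by
      ext y
      simp only [Set.mem_singleton_iff]
      constructor
      · rintro rfl; exact hw i
      · intro hy; exact (Proj.map φ hφ').isClosedEmbedding.injective (hy.trans (hw i).symm)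
    rw [heq]
    exact hcl.preimage (Proj.map φ hφ').continuous
  exact ⟨δ, 𝔰, w, hW5, hS1, hS2, hw, hS4, hS5, hS6, hS7, hS8⟩

end Summit.ResolutionOfSingularities.ResolutionOfSingularities.Cruxes.EquisingularLiftNat.Sections.Equinodal

end
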